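import Summits.QuantumFields.GaugeBoot.Eqs.GLYZc1D4Kit
import Summits.QuantumFields.GaugeBoot.ERowMerge
import HarnessLib

/-!
# Binding kit for the glyz-c1-4D equality systems — the `n log n` check (`cchkM`, merge-sort canonical forms)

Cell `pub-gaugeboot` (HOME `run/shared/lean/pub/pub-gaugeboot/`), seat lean2 (FANOUT-PLAN A126 (2)).  Same coded rows and
combination witnesses as `Eqs/GLYZc1D4Kit` (`CRow`, `decRow`, `decIdx`, `combo`); the per-row kernel check `cchkM β₀` compares
MERGE-SORT canonical forms (`ERowMerge.GRow.mcanon`) instead of insertion-sort ones (`GRow.canon`): the same normal form at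
`O(n log n)` label comparisons instead of `O(n²)` (the 204-row systems of rows C20–C31: ≈ 400 s ↦ well under a minute of kernel
time per coupling; needed for the denser glyz-c2 / KZ systems).  Soundness `rowSum4_eq_zero_of_cchkM` (+ list / indexed forms)
via `ERowMerge.rowVal_eq_zero_of_mcanon_eq_lincomb`.  Nothing here is a certificate replay.

HONEST FRAMING (page 1 of every file of this cell): certified bounds on lattice expectations at STATED coupling, gauge
group, dimension and torus size; NOT a mass gap, NOT a continuum limit, NOT a string tension, NOT large `N`; NOT
Yang–Mills-summit-bearing (barriers `FixedCouplingUltralocality`, `PerturbativeInvisibility`).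
-/

noncomputable section

open Literature.MathematicalPhysics.QuantumFieldTheory

namespace Summit.QuantumFields.GaugeBoot.GLYZc1D4

variable {L : ℕ} [NeZero L]

/-- **The per-row kernel check at coupling `β₀`, merge-sort version**: the merge-sort canonical form (`GRow.mcanon Word.ltw`)
of the decoded row equals that of its combination of literal theorem rows evaluated at `β_std = β₀`. -/
def cchkM (β₀ : ℚ) (c : CRow) : Bool :=
  decide (GRow.mcanon Word.ltw (decRow c.1) = GRow.mcanon Word.ltw (GRow.evalAt β₀ (GRow.lincomb (combo (decIdx c.2)))))

/-- **Soundness of the check**: a coded row passing `cchkM β₀` vanishes at `β_std = β₀` on every torus `(ℤ/L)⁴`, `L ≥ 4`. -/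
theorem rowSum4_eq_zero_of_cchkM (β₀ : ℚ) (hL : 4 ≤ L) (c : CRow) (h : cchkM β₀ c = true) :
    rowSum4 ((β₀ : ℚ) : ℝ) L c.row = 0 := by
  rw [rowSum4_eq_rowVal]
  exact rowVal_eq_zero_of_mcanon_eq_lincomb Word.ltw (Rung0D4.W _ L) β₀ (decRow c.1) (combo (decIdx c.2))
    (of_decide_eq_true h) (rowVal_combo _ hL (decIdx c.2))

/-- List form: if every coded row of `E` passes `cchkM β₀`, every decoded row vanishes (`L ≥ 4`). -/
theorem rowSum4_eq_zero_of_all_cchkM (β₀ : ℚ) (hL : 4 ≤ L) (E : List CRow) (h : E.all (cchkM β₀) = true) :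
    ∀ c ∈ E, rowSum4 ((β₀ : ℚ) : ℝ) L c.row = 0 :=
  fun c hc => rowSum4_eq_zero_of_cchkM β₀ hL c (List.all_eq_true.1 h c hc)

/-- Indexed form: row `j` of `E` (default: the empty row) vanishes (`L ≥ 4`). -/
theorem rowSum4_getD_eq_zero_of_all_cchkM (β₀ : ℚ) (hL : 4 ≤ L) (E : List CRow) (h : E.all (cchkM β₀) = true) (j : ℕ) :
    rowSum4 ((β₀ : ℚ) : ℝ) L (E.getD j ([], [])).row = 0 := by
  by_cases hj : j < E.length
  · rw [List.getD_eq_getElem _ _ hj]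
    exact rowSum4_eq_zero_of_all_cchkM β₀ hL E h _ (List.getElem_mem hj)
  · rw [List.getD_eq_default _ _ (Nat.le_of_not_lt hj)]
    simp [CRow.row, decRow, rowSum4]

end Summit.QuantumFields.GaugeBoot.GLYZc1D4

end
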